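import Summits.KontsevichZagierPeriods.KontsevichZagierPeriods.Theses.UnfoldedStokes
import Summits.KontsevichZagierPeriods.KontsevichZagierPeriods.Theorems.UnfoldedStokesStokesGenerationStubCubifyKernel
import Summits.KontsevichZagierPeriods.KontsevichZagierPeriods.Theorems.StokesGeneration.Negative.IffSummit
import Literature.NumberTheory.Transcendental.KZKernelConjectureForms
import Literature.ModelTheory.ExponentialFields.SemialgebraicC1Triangulation

/-!
# Strategy census s1 — kernel-checked calibrations for crux `StokesGeneration` (stmt-KontsevichZagierPeriods-3586)

Scratch file of the crux-strategist (s1). Three things are checked here: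

1. `BoundedCubeKernel` — the Kontsevich–Zagier kernel conjecture restricted to ONE closed-cube
   representation with BOUNDED integrand — is ALREADY kernel-checked equivalent to the crux and to
   the summit, using only the landed S1 `stub_cubifyKernel` (p120281). So the honest residual of the
   registered line `fibrewise_stokes` that is *provably* summit-equivalent exists today with no new
   stub: S2 (`FibrewiseStokesGeneration`) is a generator-ECONOMY strengthening of it.
2. `ContinuousCubeKernel` / `C0Cubification` — the "continuous data on the closed cube" variant
   (cubification by a `ℚ`-definable `C¹`-triangulation, Ohmoto–Shiota 2017, + rules (1a), (2)):
   typed, with the sorry-free composition `C0Cubification → ContinuousCubeKernel → StokesGeneration`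
   and `summit → ContinuousCubeKernel`. Recorded, NOT registered as a line (census §Strengthen S⁺6).
3. `C1TriangulationRat` — the `ℚ`-scope variant of the tree's named fact
   `OhmotoShiota2017_c1Triangulation` that any use of triangulations inside the KZ calculus needs
   (input AND output `ℚ`-semialgebraic). Typed only.
-/

noncomputable section

namespace Summit.KontsevichZagierPeriods.KontsevichZagierPeriods.Cruxes.StokesGeneration.CensusS1

open MeasureTheory Set
open Literature.NumberTheory.Transcendental
open Literature.NumberTheory.Transcendental.KZ
open Literature.ModelTheory.ExponentialFields (IsSemialgebraic IsSemialgHomeomorphOn openSimplex)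
open Summit.KontsevichZagierPeriods.KontsevichZagierPeriods.Theses.UnfoldedStokes (StokesGeneration)
open Summit.KontsevichZagierPeriods.KontsevichZagierPeriods.Cruxes.StokesGeneration.FibrewiseStokes
  (stub_cubifyKernel)
open Summit.KontsevichZagierPeriods.UnfoldedStokes.StokesGenerationNegative
  (stokesGeneration_iff_kernel stokesGeneration_iff_summit)

/-- The closed unit cube `[0,1]^M` as a `Set.pi`. -/
abbrev cube (M : ℕ) : Set (Fin M → ℝ) := Set.pi Set.univ (fun _ : Fin M => Set.Icc (0:ℝ) 1)

/-- **K_bdd.** The kernel conjecture for ONE closed-cube representation with bounded integrand. -/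
def BoundedCubeKernel : Prop :=
  ∀ (M : ℕ) (t : IntegralRep M), t.domain = cube M →
    (∃ B : ℝ, ∀ z ∈ t.domain, |t.integrand z| ≤ B) → t.value = 0 → of t ∈ relations

/-- **K_cont.** The kernel conjecture for ONE closed-cube representation whose integrand is
continuous on the CLOSED cube. -/
def ContinuousCubeKernel : Prop :=
  ∀ (M : ℕ) (t : IntegralRep M), t.domain = cube M →
    ContinuousOn t.integrand (cube M) → t.value = 0 → of t ∈ relations

/-- **C⁰-cubification** (resolution-free normal form with continuous data): every formal
combination is congruent modulo the moves to ONE closed-cube representation with integrand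
continuous on the closed cube. Expected proof: Cresson–Viu-Sos volume normal form (landed,
`KZ.exists_sub_isBounded`), a `ℚ`-definable `C¹`-triangulation of each compact piece
(`C1TriangulationRat` below), rule (1a) over top simplices, rule (2) along
`f ∘ A_σ ∘ P : (0,1)^M → f(Int σ)` with `P` the polynomial cube-to-simplex map, whose Jacobian
`|det D(f ∘ A_σ ∘ P)|` is continuous on the closed cube; lift to a common dimension, merge (1b). -/
def C0Cubification : Prop :=
  ∀ x : FormalRep, ∃ (M : ℕ) (t : IntegralRep M), t.domain = cube M ∧
    ContinuousOn t.integrand (cube M) ∧ x - of t ∈ relations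

/-- **ℚ-scope variant of Ohmoto–Shiota's `C¹`-triangulation** (printed over any real closed field;
apply over the real closure of `ℚ` and transfer): `ℚ`-semialgebraic compact input, finite complex,
`C¹` realisation whose graph over `|K|` is `ℚ`-semialgebraic. -/
def C1TriangulationRat : Prop :=
  ∀ (N : ℕ) (X : Set (Fin N → ℝ)), IsSemialgebraic ℚ X → IsCompact X →
    ∀ 𝒜 : Finset (Set (Fin N → ℝ)), (∀ A ∈ 𝒜, A ⊆ X ∧ IsSemialgebraic ℚ A) →
      ∃ (n : ℕ) (K : Geometry.SimplicialComplex ℝ (Fin n → ℝ)) (f : (Fin n → ℝ) → (Fin N → ℝ))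
        (g : (Fin N → ℝ) → (Fin n → ℝ)),
        K.faces.Finite ∧ (∀ σ ∈ K.faces, ∀ v ∈ σ, ∀ i, IsAlgebraic ℚ (v i)) ∧
          IsSemialgHomeomorphOn ℚ K.space X f g ∧ ContDiff ℝ 1 f ∧
          ∀ A ∈ 𝒜, ∀ σ ∈ K.faces, (f '' openSimplex ℝ σ ∩ A).Nonempty → f '' openSimplex ℝ σ ⊆ A

/-! ## 1. `K_bdd` is the crux is the summit (sorry-free) -/

theorem stokesGeneration_of_boundedCubeKernel (h : BoundedCubeKernel) : StokesGeneration := by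
  rw [stokesGeneration_iff_kernel]
  intro x hx
  obtain ⟨M, t, htd, htB, hxt⟩ := stub_cubifyKernel x
  have hval : t.value = 0 := by
    have h0 := relations_le_ker_eval_holds hxt
    rwa [AddMonoidHom.mem_ker, map_sub, hx, zero_sub, neg_eq_zero, eval_of] at h0
  have ht : of t ∈ relations := h M t htd htB hval
  have e : x = (x - of t) + of t := by abel
  rw [e]
  exact relations.add_mem hxt ht

theorem boundedCubeKernel_of_stokesGeneration (h : StokesGeneration) : BoundedCubeKernel := by
  rw [stokesGeneration_iff_kernel] at h
  intro M t _ _ hval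
  exact h _ (by simp [eval_of, hval])

/-- **Calibration.** `K_bdd ↔ crux`. -/
theorem boundedCubeKernel_iff_crux : BoundedCubeKernel ↔ StokesGeneration :=
  ⟨stokesGeneration_of_boundedCubeKernel, boundedCubeKernel_of_stokesGeneration⟩

/-- **Calibration.** `K_bdd ↔ summit`. -/
theorem boundedCubeKernel_iff_summit : BoundedCubeKernel ↔ _root_.KontsevichZagierPeriods :=
  boundedCubeKernel_iff_crux.trans stokesGeneration_iff_summit

/-! ## 2. The continuous-data variant composes the same way -/

theorem stokesGeneration_of_continuousCubeKernel (hC : C0Cubification) (h : ContinuousCubeKernel) :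
    StokesGeneration := by
  rw [stokesGeneration_iff_kernel]
  intro x hx
  obtain ⟨M, t, htd, htc, hxt⟩ := hC x
  have hval : t.value = 0 := by
    have h0 := relations_le_ker_eval_holds hxt
    rwa [AddMonoidHom.mem_ker, map_sub, hx, zero_sub, neg_eq_zero, eval_of] at h0
  have ht : of t ∈ relations := h M t htd htc hval
  have e : x = (x - of t) + of t := by abel
  rw [e]
  exact relations.add_mem hxt ht

theorem continuousCubeKernel_of_summit (h : _root_.KontsevichZagierPeriods) : ContinuousCubeKernel := by
  rw [← stokesGeneration_iff_summit, stokesGeneration_iff_kernel] at h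
  intro M t _ _ hval
  exact h _ (by simp [eval_of, hval])

/-- `K_cont` is weaker than `K_bdd` on the nose (a continuous function on the compact cube is
bounded), hence implied by the crux unconditionally. -/
theorem continuousCubeKernel_of_boundedCubeKernel (h : BoundedCubeKernel) : ContinuousCubeKernel := by
  intro M t htd htc hval
  refine h M t htd ?_ hval
  have hK : IsCompact (cube M) := isCompact_univ_pi fun _ => isCompact_Icc
  obtain ⟨B, hB⟩ := (hK.image_of_continuousOn htc).isBounded.subset_closedBall 0
  refine ⟨B, fun z hz => ?_⟩
  have := hB (Set.mem_image_of_mem _ (htd ▸ hz : z ∈ cube M))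
  simpa [Real.norm_eq_abs] using this

end Summit.KontsevichZagierPeriods.KontsevichZagierPeriods.Cruxes.StokesGeneration.CensusS1
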